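import Summits.CriticalPhenomena.PercolationContinuityZ3.Theorems.PercNearOneGluingNoHeavyQuantGatedSliceMixLawQRoutingDeep
import Summits.CriticalPhenomena.PercolationContinuityZ3.Theorems.PercNearOneGluingNoHeavyQuantGatedSliceMixLawHeavyTop
import HarnessLib

/-!
# QUANT lane R8, T-DEC, leg (III), blob case — the moved two-point law `P` ALONE: three explicit routings (heavy top; both lows into
# the mid; the unshifted low incompatible with the mid) — tools for the P-cells `MixLawCellPCheap` / `MixLawCellPDear` of regime B

builds on p205010 (kernel theorem, internal audit signed; external expert review pending)

Support file (`--supports stmt-CriticalPhenomena-4575`), QUANT lane seat prim-quant-arm-2 (gen 36), rung R8 of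
`run/shared/lean/prim/quant/LADDER.md`.  Theorems only, standard axioms, no sorries, no definitions.  Consumer:
`…QuantGatedSliceMixLawPCells` (this seat).  Tools: arm-1 g41's routing shell `mixLawQ_decAtT_of_routing_deep` (`…QRoutingDeep`),
`usage_mid_mul_le` (`…FlowPieces`), arm-2's heavy-top machinery (`…HeavyTop`).

SETTING.  `P = z·δ₀ + m₁δ_{k₁} + m₁'δ_ℓ + m₂δ_{k₂} + m₂'δ_{k₂+a}` (`ℓ = k₁ + a`, `m₁ = (1−z)(1−λ)(1−g)`, `m₁' = (1−z)(1−λ)g`,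
`m₂ = (1−z)λ(1−g)`, `m₂' = (1−z)λg`, `(1−z)(k₁ + (k₂−k₁)λ) = S`, `t = S + ag(1−z)`, `u = y/(1−y)`), `k₁` and `ℓ` `t`-lows, `k₂ ≤ j` a mid
compatible with `ℓ`, `k₂ + a` a giant; `U_d = usage(ℓ,k₂)`, `U₁ = usage(k₁,k₂)`.  THE MEAN IDENTITY
`t·z = (k₂−t)m₂ + (k₂+a−t)m₂' − (t−k₁)m₁ − (t−ℓ)m₁'`, `usage(l,k₂)·(k₂−t) ≤ t − l` (`usage_mid_mul_le`, needs only `y·k₂ ≤ t`) and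
`y(k₂ + a) ≤ t` (top-affordability + threshold) give the offer inequality of the routing shell whenever the mid holds what is routed into it.

* `LawDec.decAtT_movedTwoPoint_of_heavyTop` — `y ≤ (1−z)λ ⟹ P` DEC (the P-alone statement inside arm-2's `gatedSliceMixLaw_heavyTop`).
* `LawDec.movedTwoPoint_offer_of_full_mid` — the offer inequality from the mean identity.
* `LawDec.decAtT_movedTwoPoint_of_midFit` — `k₁ ≥ 1` compatible, `U₁m₁ + U_dm₁' ≤ m₂` ⟹ `P` DEC (both lows into the mid).
* `LawDec.decAtT_movedTwoPoint_of_incompLow` — `k₁ ≥ 1`, `k₁ + k₂ ≤ t`, `U_dm₁' ≤ m₂` ⟹ `P` DEC (`ℓ` into the mid, `k₁` and the zeros to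
  the giant: `u(z + m₁) ≤ m₂'` by the mean identity, `(k₂−t)m₂ ≤ −k₁m₂` and `k₁(m₁ − m₂) ≤ (t−ℓ)m₁'` — `t − ℓ ≥ 2k₁`, and `λ ≥ ½` or
  `g ≥ ½`).
HONEST STATUS: support lemmas; `MixLawRegimeB`, `GatedSliceMixLaw'`, CW, `SingleGateConvClosed`, `TreeDEC`, `FarTreeRow` OPEN; RATE class
log* / honest sentence unchanged.

[this work]; routing shell: prim-quant-arm-1 g39–g41; heavy top: arm-2 (this lane).  Nothing here is cited as a published result.  The
gluing rows served [cite: KozmaNitzan2024, Conjecture 3 (p. 15)]; product measure [cite: Grimmett1999, §1.3 p. 10].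
-/

noncomputable section

namespace Summit.CriticalPhenomena.PercolationContinuityZ3.Theorems

namespace Quant

open Finset

/-- the two-point law `{lo, hi; g}` (as in `…QuantLawDEC`) -/
local notation3 "TP[" lo ", " hi ", " g ", " h "]" =>
  (g : ℝ) * (if (h : ℕ) = (hi : ℕ) then (1 : ℝ) else 0) + (1 - (g : ℝ)) * (if (h : ℕ) = (lo : ℕ) then (1 : ℝ) else 0)

namespace LawDec

/-! ### The heavy top, P alone -/

set_option maxHeartbeats 400000 in
/-- **HEAVY TOP ⟹ THE MOVED LAW IS DEC BY ITSELF** (`y ≤ (1−z)λ`): the P-alone content of `gatedSliceMixLaw_heavyTop` (gate by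
`q = 1−z` of the shifted two-blob law, which is SDEC up to `q`). [this work] -/
theorem decAtT_movedTwoPoint_of_heavyTop (y z g S lam : ℝ) (a j M k₁ k₂ : ℕ)
    (hy0 : 0 < y) (hy1 : y < 1) (hz0 : 0 ≤ z) (hz1 : z < 1) (hg1 : g ≤ 1) (hyg : y ≤ (1 - z) * g) (ha : 1 ≤ a)
    (hS0 : 0 < S) (hk : k₁ ≤ k₂) (hk₂M : k₂ ≤ M) (hlam1 : lam ≤ 1)
    (hmean : (1 - z) * ((k₁ : ℝ) + ((k₂ : ℝ) - k₁) * lam) = S)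
    (hheavy : y ≤ (1 - z) * lam) :
    DECAtT y (S + (a : ℝ) * g * (1 - z)) j (M + a)
      (fun p => z * (if p = 0 then (1 : ℝ) else 0) + (1 - z) * slice (fun q => TP[k₁, k₂, lam, q]) a g p) := by
  -- the gate `q = 1 - z` and the base floor `x = y / q`
  set q : ℝ := 1 - z with hq
  have hq0 : 0 < q := by rw [hq]; linarith
  have hq1 : q ≤ 1 := by rw [hq]; linarith
  set x : ℝ := y / q with hx
  have hx0 : 0 < x := div_pos hy0 hq0
  have hqx : q * x = y := by rw [hx]; field_simp
  have hqx1 : q * x < 1 := by rw [hqx]; exact hy1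
  have hxg : x ≤ g := by rw [hx, div_le_iff₀ hq0]; linarith
  have hxlam : x ≤ lam := by rw [hx, div_le_iff₀ hq0]; linarith
  have hg0 : 0 ≤ g := hx0.le.trans hxg
  have hlam0 : 0 ≤ lam := hx0.le.trans hxlam
  obtain ⟨b, rfl⟩ : ∃ b, k₂ = k₁ + b := ⟨k₂ - k₁, by omega⟩
  -- the two-blob law and its shift
  set L : ℕ → ℝ := slice (fun t => TP[0, b, lam, t]) a g with hL
  obtain ⟨L0, LM, L1, Lmean⟩ := twoBlob_laws a b lam g hlam0 hlam1 hg0 hg1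
  have Lta : x * ((b + a : ℕ) : ℝ) ≤ ∑ t ∈ Finset.range (b + a + 1), (t : ℝ) * L t := by
    rw [hL, Lmean]; push_cast
    nlinarith [mul_le_mul_of_nonneg_left hxlam (Nat.cast_nonneg b), mul_le_mul_of_nonneg_left hxg (Nat.cast_nonneg a)]
  set Lk : ℕ → ℝ := fun t => if k₁ ≤ t then L (t - k₁) else 0 with hLk
  obtain ⟨Lk0, LkM, Lk1, Lkmean⟩ := shift_laws k₁ (b + a) L L0 LM L1
  have hLkS : SDECUpTo x q (k₁ + (b + a)) Lk := by
    rcases Nat.eq_zero_or_pos k₁ with hk0 | hkpos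
    · have e : Lk = L := by
        funext t; rw [hLk]; simp only [hk0, zero_le, if_true, Nat.sub_zero]
      rw [e, hk0, Nat.zero_add]
      rcases Nat.eq_zero_or_pos b with hb0 | hbpos
      · exfalso
        have : S = 0 := by rw [← hmean]; simp [hk0, hb0]
        linarith
      · exact sdecUpTo_twoBlob x q lam g b a hx0 hq1 hqx1 hxlam hlam1 hxg hg1 hbpos ha
    · have hLS : SDECUpTo x q (b + a) L := by
        rcases Nat.eq_zero_or_pos b with hb0 | hbpos
        · have e : L = fun t => TP[0, a, g, t] := by
            rw [hL, hb0]
            have e1 : (fun t : ℕ => TP[0, 0, lam, t]) = fun t => if t = 0 then (1 : ℝ) else 0 := by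
              funext t; split_ifs <;> ring
            rw [e1, slice_delta_zero a g ha]
          rw [e, hb0, Nat.zero_add]
          exact sdecUpTo_blob x q g a hx0 hq1 hqx1 hxg hg1 ha
        · exact sdecUpTo_twoBlob x q lam g b a hx0 hq1 hqx1 hxlam hlam1 hxg hg1 hbpos ha
      exact gatedShift_sdecUpTo x q k₁ (b + a) L hx0 (hxg.trans hg1) hq1 hqx1 hkpos L0 LM L1 Lta hLS
  have Lkta : x * ((k₁ + (b + a) : ℕ) : ℝ) ≤ ∑ t ∈ Finset.range (k₁ + (b + a) + 1), (t : ℝ) * Lk t := by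
    rw [Lkmean]
    have hx1 : x ≤ 1 := hxg.trans hg1
    have : x * (k₁ : ℝ) ≤ k₁ := by nlinarith [(Nat.cast_nonneg k₁ : (0 : ℝ) ≤ k₁)]
    push_cast at Lta ⊢
    nlinarith
  have hdec := decAtT_gate_of_sdecUpTo x q (k₁ + (b + a)) (M + a) j Lk hx0 hq0 hq1 hqx1 Lk0 LkM Lk1 Lkta hLkS (by omega)
  rw [hqx, Lkmean, hL, Lmean] at hdec
  have et : q * ((b : ℝ) * lam + (a : ℝ) * g + (k₁ : ℝ)) = S + (a : ℝ) * g * (1 - z) := by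
    rw [← hmean, hq]; push_cast; ring
  rw [et] at hdec
  have elaw := movedPair_eq_gate_shift_twoBlob z lam g k₁ b a
  rw [show (1 : ℝ) - z = q from rfl] at elaw
  rw [elaw]
  exact hdec

/-! ### The offer inequality of the full-mid routing, from the mean identity -/

/-- **the zeros fit the priced leftovers when the mid `k₂` holds both nonzero lows** (`u = y/(1−y)`, `κ(k₂) = (k₂−t)⁺` for the
mid `k₂ ≤ j`): if the load of the mid satisfies `loadK·(k₂ − t) ≤ (t−k₁)m₁ + (t−ℓ)m₁'` whenever `t < k₂` (as it does when
`loadK = U₁m₁ + U_dm₁'`, by `usage_mid_mul_le`), then `t·z ≤ κ(k₂)(m₂ − loadK) + t/u·m₂'` — the offer hypothesis of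
`mixLawQ_decAtT_of_routing_deep` with nothing sent to the giant — by the mean identity `t z = (k₂−t)m₂ + (k₂+a−t)m₂' − (t−k₁)m₁ − (t−ℓ)m₁'`
and `y(k₂ + a) ≤ t`. [this work] -/
theorem movedTwoPoint_offer_of_full_mid (y z g S lam loadK : ℝ) (a j k₁ k₂ : ℕ)
    (hy0 : 0 < y) (hz1 : z < 1) (hg0 : 0 ≤ g) (hg1 : g ≤ 1) (hyg : y ≤ (1 - z) * g) (hlam0 : 0 ≤ lam) (hlam1 : lam ≤ 1)
    (hyk₂ : y * (k₂ : ℝ) ≤ S) (hmean : (1 - z) * ((k₁ : ℝ) + ((k₂ : ℝ) - k₁) * lam) = S)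
    (hk₁low : 2 * (k₁ : ℝ) < S + (a : ℝ) * g * (1 - z)) (hPlow : 2 * ((k₁ + a : ℕ) : ℝ) < S + (a : ℝ) * g * (1 - z))
    (hk₂j : k₂ ≤ j)
    (hload : S + (a : ℝ) * g * (1 - z) < (k₂ : ℝ) →
      loadK * ((k₂ : ℝ) - (S + (a : ℝ) * g * (1 - z)))
        ≤ (S + (a : ℝ) * g * (1 - z) - k₁) * ((1 - z) * (1 - lam) * (1 - g))
          + (S + (a : ℝ) * g * (1 - z) - ((k₁ + a : ℕ) : ℝ)) * ((1 - z) * (1 - lam) * g)) :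
    (S + (a : ℝ) * g * (1 - z)) * z ≤
      (if j + 1 ≤ k₂ then (S + (a : ℝ) * g * (1 - z)) * (1 - y) / y
        else if S + (a : ℝ) * g * (1 - z) < (k₂ : ℝ) then (k₂ : ℝ) - (S + (a : ℝ) * g * (1 - z)) else 0)
        * ((1 - z) * lam * (1 - g) - loadK)
      + (S + (a : ℝ) * g * (1 - z)) * (1 - y) / y * ((1 - z) * lam * g - 0) := by
  set t : ℝ := S + (a : ℝ) * g * (1 - z) with ht
  have h1z : 0 < 1 - z := by linarith
  have ha0 : (0 : ℝ) ≤ a := Nat.cast_nonneg a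
  have hk₁0 : (0 : ℝ) ≤ k₁ := Nat.cast_nonneg k₁
  have hdcast : ((k₁ + a : ℕ) : ℝ) = (k₁ : ℝ) + a := by push_cast; ring
  set A : ℝ := (1 - z) * (1 - lam) * (1 - g) with hA
  set B : ℝ := (1 - z) * (1 - lam) * g with hB
  set C : ℝ := (1 - z) * lam * (1 - g) with hC
  set D : ℝ := (1 - z) * lam * g with hD
  -- the mean identity: t z = (k₂−t)C + (k₂+a−t)D − (t−k₁)A − (t−ℓ)B
  have eMI : t * z = ((k₂ : ℝ) - t) * C + ((k₂ : ℝ) + a - t) * D - (t - k₁) * A - (t - ((k₁ : ℝ) + a)) * B := by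
    simp only [hA, hB, hC, hD, ht]
    linear_combination (-1 : ℝ) * hmean
  have hB0 : 0 ≤ B := mul_nonneg (mul_nonneg h1z.le (by linarith)) hg0
  have hD0 : 0 ≤ D := mul_nonneg (mul_nonneg h1z.le hlam0) hg0
  -- y(k₂ + a) ≤ t, i.e. (k₂ + a − t) ≤ t(1−y)/y
  have hyt : y * ((k₂ : ℝ) + a) ≤ t := by
    rw [ht]
    have : y * (a : ℝ) ≤ (a : ℝ) * g * (1 - z) := by nlinarith
    linarith
  have hGiant : ((k₂ : ℝ) + a - t) * D ≤ t * (1 - y) / y * D := by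
    refine mul_le_mul_of_nonneg_right ?_ hD0
    rw [le_div_iff₀ hy0]
    nlinarith
  have hnj : ¬ (j + 1 ≤ k₂) := by omega
  have hPlow' : 2 * ((k₁ : ℝ) + a) < t := by rw [← hdcast]; exact hPlow
  have hA0 : 0 ≤ A := mul_nonneg (mul_nonneg h1z.le (by linarith)) (by linarith)
  have hC0 : 0 ≤ C := mul_nonneg (mul_nonneg h1z.le hlam0) (by linarith)
  have h2 : 0 ≤ (t - k₁) * A := mul_nonneg (by linarith) hA0
  have h3 : 0 ≤ (t - ((k₁ : ℝ) + a)) * B := mul_nonneg (by linarith) hB0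
  rw [if_neg hnj, sub_zero]
  by_cases htk : t < (k₂ : ℝ)
  · rw [if_pos htk]
    have hL := hload htk
    rw [hdcast] at hL
    have e1 : ((k₂ : ℝ) - t) * (C - loadK) = ((k₂ : ℝ) - t) * C - loadK * ((k₂ : ℝ) - t) := by ring
    linarith [eMI, hGiant, hL, e1]
  · rw [if_neg htk, zero_mul, zero_add]
    have hkt : (k₂ : ℝ) - t ≤ 0 := by linarith
    have h1 : ((k₂ : ℝ) - t) * C ≤ 0 := mul_nonpos_of_nonpos_of_nonneg hkt hC0
    linarith [eMI, hGiant, h1, h2, h3]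

/-! ### The three routings -/

set_option maxHeartbeats 800000 in
/-- **both nonzero lows fit into the mid** (`k₁ ≥ 1` compatible with `k₂`, `U₁m₁ + U_dm₁' ≤ m₂`): `P` is DEC — route `k₁, ℓ → k₂`, nothing
to the giant, the zeros by `movedTwoPoint_offer_of_full_mid`. [this work] -/
theorem decAtT_movedTwoPoint_of_midFit (y z g S lam : ℝ) (a j M k₁ k₂ : ℕ)
    (hy0 : 0 < y) (hy1 : y < 1) (hz0 : 0 ≤ z) (hz1 : z < 1) (hg1 : g ≤ 1) (hyg : y ≤ (1 - z) * g) (ha1 : 1 ≤ a)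
    (hta : y * (M : ℝ) ≤ S) (hk : k₁ ≤ k₂) (hk₂M : k₂ ≤ M) (hlam0 : 0 ≤ lam) (hlam1 : lam ≤ 1)
    (hmean : (1 - z) * ((k₁ : ℝ) + ((k₂ : ℝ) - k₁) * lam) = S)
    (hk₁ : 1 ≤ k₁) (hk₁low : 2 * (k₁ : ℝ) < S + (a : ℝ) * g * (1 - z)) (hPj : k₁ + a ≤ j)
    (hPlow : 2 * ((k₁ + a : ℕ) : ℝ) < S + (a : ℝ) * g * (1 - z))
    (hk₂j : k₂ ≤ j) (hk₂mid : S + (a : ℝ) * g * (1 - z) ≤ 2 * (k₂ : ℝ)) (hcomp : S + (a : ℝ) * g * (1 - z) < ((k₁ + a : ℕ) : ℝ) + k₂)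
    (hG : j + 1 ≤ k₂ + a) (hc1 : S + (a : ℝ) * g * (1 - z) < (k₁ : ℝ) + k₂)
    (hfit : usage y (S + (a : ℝ) * g * (1 - z)) j k₁ k₂ * ((1 - z) * (1 - lam) * (1 - g))
      + usage y (S + (a : ℝ) * g * (1 - z)) j (k₁ + a) k₂ * ((1 - z) * (1 - lam) * g) ≤ (1 - z) * lam * (1 - g)) :
    DECAtT y (S + (a : ℝ) * g * (1 - z)) j (M + a)
      (fun p => z * (if p = 0 then (1 : ℝ) else 0) + (1 - z) * slice (fun q => TP[k₁, k₂, lam, q]) a g p) := by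
  set t : ℝ := S + (a : ℝ) * g * (1 - z) with ht
  have h1z : 0 < 1 - z := by linarith
  have hg0 : 0 < g := by nlinarith
  have hyk₂ : y * (k₂ : ℝ) ≤ S := le_trans (mul_le_mul_of_nonneg_left (by exact_mod_cast hk₂M) hy0.le) hta
  have ha0 : (0 : ℝ) ≤ a := Nat.cast_nonneg a
  have hSt : S ≤ t := by rw [ht]; nlinarith [mul_nonneg (mul_nonneg ha0 hg0.le) h1z.le]
  set A : ℝ := (1 - z) * (1 - lam) * (1 - g) with hA
  set B : ℝ := (1 - z) * (1 - lam) * g with hB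
  set D : ℝ := (1 - z) * lam * g with hD
  have hA0 : 0 ≤ A := mul_nonneg (mul_nonneg h1z.le (by linarith)) (by linarith)
  have hB0 : 0 ≤ B := mul_nonneg (mul_nonneg h1z.le (by linarith)) hg0.le
  have hD0 : 0 ≤ D := mul_nonneg (mul_nonneg h1z.le hlam0) hg0.le
  have hdcast : ((k₁ + a : ℕ) : ℝ) = (k₁ : ℝ) + a := by push_cast; ring
  have hU1 : usage y t j k₁ k₂ * ((k₂ : ℝ) - t) ≤ t - k₁ :=
    usage_mid_mul_le y t j k₁ k₂ hy0 hy1 hk₁low hk₂j hc1 (by linarith)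
  have hUd : usage y t j (k₁ + a) k₂ * ((k₂ : ℝ) - t) ≤ t - ((k₁ + a : ℕ) : ℝ) :=
    usage_mid_mul_le y t j (k₁ + a) k₂ hy0 hy1 hPlow hk₂j hcomp (by linarith)
  have hoffer := movedTwoPoint_offer_of_full_mid y z g S lam
    (usage y t j k₁ k₂ * A + usage y t j (k₁ + a) k₂ * B) a j k₁ k₂ hy0 hz1 hg0.le hg1 hyg hlam0 hlam1 hyk₂ hmean hk₁low hPlow hk₂j
    (fun _ => by
      rw [hdcast] at hUd
      have h1 := mul_le_mul_of_nonneg_right hU1 hA0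
      have h2 := mul_le_mul_of_nonneg_right hUd hB0
      nlinarith [h1, h2])
  refine mixLawQ_decAtT_of_routing_deep y z g S lam a j M k₁ k₂ A 0 B 0 hy0 hy1 hz0 hz1 hg1 hyg ha1 hta hk hk₂M hlam0 hlam1 hmean
    hk₁ hPj hPlow (Or.inl hk₂mid) hG hA0 le_rfl hB0 le_rfl (by ring) (by ring) (fun _ => Or.inr hc1) (fun _ => Or.inr hcomp)
    hfit (by rw [mul_zero, mul_zero, add_zero]; exact hD0) ?_
  rw [mul_zero, mul_zero, add_zero]
  exact hoffer

set_option maxHeartbeats 800000 in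
/-- **`k₁` incompatible with the mid** (`k₁ ≥ 1`, `k₁ + k₂ ≤ t`, `U_d m₁' ≤ m₂`): `P` is DEC — `ℓ` into the mid, `k₁` and the zeros to the
giant, which holds them: `u(z + m₁) ≤ m₂'` by the mean identity, `(k₂ − t)m₂ ≤ −k₁m₂`, and `k₁(m₁ − m₂) ≤ (t−ℓ)m₁'` (`t − ℓ ≥ 2k₁`;
`λ ≥ ½`, or `g ≥ ½` from `ag > (k₁+k₂)/2 > a/2… `). [this work] -/
theorem decAtT_movedTwoPoint_of_incompLow (y z g S lam : ℝ) (a j M k₁ k₂ : ℕ)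
    (hy0 : 0 < y) (hy1 : y < 1) (hz0 : 0 ≤ z) (hz1 : z < 1) (hg1 : g ≤ 1) (hyg : y ≤ (1 - z) * g) (ha1 : 1 ≤ a)
    (hta : y * (M : ℝ) ≤ S) (hk : k₁ ≤ k₂) (hk₂M : k₂ ≤ M) (hlam0 : 0 ≤ lam) (hlam1 : lam ≤ 1)
    (hmean : (1 - z) * ((k₁ : ℝ) + ((k₂ : ℝ) - k₁) * lam) = S)
    (hk₁ : 1 ≤ k₁) (hk₁low : 2 * (k₁ : ℝ) < S + (a : ℝ) * g * (1 - z)) (hPj : k₁ + a ≤ j)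
    (hPlow : 2 * ((k₁ + a : ℕ) : ℝ) < S + (a : ℝ) * g * (1 - z))
    (hk₂j : k₂ ≤ j) (hk₂mid : S + (a : ℝ) * g * (1 - z) ≤ 2 * (k₂ : ℝ)) (hcomp : S + (a : ℝ) * g * (1 - z) < ((k₁ + a : ℕ) : ℝ) + k₂)
    (hG : j + 1 ≤ k₂ + a) (hc1 : (k₁ : ℝ) + k₂ ≤ S + (a : ℝ) * g * (1 - z))
    (hsat : usage y (S + (a : ℝ) * g * (1 - z)) j (k₁ + a) k₂ * ((1 - z) * (1 - lam) * g) ≤ (1 - z) * lam * (1 - g)) :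
    DECAtT y (S + (a : ℝ) * g * (1 - z)) j (M + a)
      (fun p => z * (if p = 0 then (1 : ℝ) else 0) + (1 - z) * slice (fun q => TP[k₁, k₂, lam, q]) a g p) := by
  set t : ℝ := S + (a : ℝ) * g * (1 - z) with ht
  have h1z : 0 < 1 - z := by linarith
  have h1y : 0 < 1 - y := by linarith
  have hg0 : 0 < g := by nlinarith
  have hu0 : 0 < y / (1 - y) := div_pos hy0 h1y
  have hyk₂ : y * (k₂ : ℝ) ≤ S := le_trans (mul_le_mul_of_nonneg_left (by exact_mod_cast hk₂M) hy0.le) hta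
  have ha0 : (0 : ℝ) ≤ a := Nat.cast_nonneg a
  have hk₁0 : (0 : ℝ) ≤ k₁ := Nat.cast_nonneg k₁
  have hSt : S ≤ t := by rw [ht]; nlinarith [mul_nonneg (mul_nonneg ha0 hg0.le) h1z.le]
  have htpos : 0 < t := by linarith
  have hdcast : ((k₁ + a : ℕ) : ℝ) = (k₁ : ℝ) + a := by push_cast; ring
  set A : ℝ := (1 - z) * (1 - lam) * (1 - g) with hA
  set B : ℝ := (1 - z) * (1 - lam) * g with hB
  set C : ℝ := (1 - z) * lam * (1 - g) with hC
  set D : ℝ := (1 - z) * lam * g with hD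
  have hA0 : 0 ≤ A := mul_nonneg (mul_nonneg h1z.le (by linarith)) (by linarith)
  have hB0 : 0 ≤ B := mul_nonneg (mul_nonneg h1z.le (by linarith)) hg0.le
  have hC0 : 0 ≤ C := mul_nonneg (mul_nonneg h1z.le hlam0) (by linarith)
  have hUG : usage y t j k₁ (k₂ + a) = y / (1 - y) := usage_giant_eq y t j k₁ (k₂ + a) hG
  have eMI : t * z = ((k₂ : ℝ) - t) * C + ((k₂ : ℝ) + a - t) * D - (t - k₁) * A - (t - ((k₁ : ℝ) + a)) * B := by
    simp only [hA, hB, hC, hD, ht]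
    linear_combination (-1 : ℝ) * hmean
  have hD0 : 0 ≤ D := mul_nonneg (mul_nonneg h1z.le hlam0) hg0.le
  have hyt : y * ((k₂ : ℝ) + a) ≤ t := by
    rw [ht]
    have : y * (a : ℝ) ≤ (a : ℝ) * g * (1 - z) := by nlinarith
    linarith
  have hGiant : ((k₂ : ℝ) + a - t) * D ≤ t * (1 - y) / y * D := by
    refine mul_le_mul_of_nonneg_right ?_ hD0
    rw [le_div_iff₀ hy0]
    nlinarith
  -- t − ℓ ≥ 2k₁ :  S ≤ k₂ and S > 2k₁ + a
  have hSk₂ : S ≤ (k₂ : ℝ) := by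
    have hkr : (k₁ : ℝ) ≤ k₂ := by exact_mod_cast hk
    have hX0 : 0 ≤ (k₁ : ℝ) + ((k₂ : ℝ) - k₁) * lam := by nlinarith
    have h1 : (k₁ : ℝ) + ((k₂ : ℝ) - k₁) * lam ≤ k₂ := by nlinarith
    have h2 : (1 - z) * ((k₁ : ℝ) + ((k₂ : ℝ) - k₁) * lam) ≤ (k₁ : ℝ) + ((k₂ : ℝ) - k₁) * lam :=
      mul_le_of_le_one_left hX0 (by linarith)
    linarith
  have hagag : (a : ℝ) * g * (1 - z) ≤ (a : ℝ) * g := mul_le_of_le_one_right (mul_nonneg ha0 hg0.le) (by linarith)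
  have hag : (a : ℝ) * g ≤ a := mul_le_of_le_one_right ha0 hg1
  have htl : 2 * (k₁ : ℝ) ≤ t - ((k₁ : ℝ) + a) := by rw [hdcast] at hPlow; linarith
  -- the key inequality k₁(A − C) ≤ (t − ℓ)B
  have hkey : (k₁ : ℝ) * (A - C) ≤ (t - ((k₁ : ℝ) + a)) * B := by
    have eAC : A - C = (1 - z) * ((1 - g) * (1 - 2 * lam)) := by simp only [hA, hC]; ring
    by_cases hl : 1 / 2 ≤ lam
    · have hAC : A - C ≤ 0 := by
        rw [eAC]; exact mul_nonpos_of_nonneg_of_nonpos h1z.le (mul_nonpos_of_nonneg_of_nonpos (by linarith) (by linarith))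
      exact le_trans (mul_nonpos_of_nonneg_of_nonpos hk₁0 hAC) (mul_nonneg (by linarith) hB0)
    · have hl' : lam < 1 / 2 := not_le.1 hl
      have hkr : (k₁ : ℝ) ≤ k₂ := by exact_mod_cast hk
      have hX0 : 0 ≤ (k₁ : ℝ) + ((k₂ : ℝ) - k₁) * lam := by nlinarith
      have hX1 : (1 - z) * ((k₁ : ℝ) + ((k₂ : ℝ) - k₁) * lam) ≤ (k₁ : ℝ) + ((k₂ : ℝ) - k₁) * lam :=
        mul_le_of_le_one_left hX0 (by linarith)
      have hX2 : ((k₂ : ℝ) - k₁) * lam ≤ ((k₂ : ℝ) - k₁) * (1 / 2) := mul_le_mul_of_nonneg_left hl'.le (by linarith)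
      have hS2 : S ≤ ((k₁ : ℝ) + k₂) / 2 := by linarith
      have hag2 : ((k₁ : ℝ) + k₂) / 2 ≤ (a : ℝ) * g := by linarith
      have hak₂ : (a : ℝ) < k₂ := by rw [hdcast] at hPlow; linarith
      have hg12 : 1 / 2 ≤ g := by
        by_contra hgc
        have hgc' : g < 1 / 2 := not_le.1 hgc
        have hapos : (0 : ℝ) < a := by exact_mod_cast (Nat.lt_of_lt_of_le Nat.zero_lt_one ha1)
        have : (a : ℝ) * g < (a : ℝ) * (1 / 2) := mul_lt_mul_of_pos_left hgc' hapos
        linarith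
      have h4a : (1 - g) * (1 - 2 * lam) ≤ g * (1 - 2 * lam) := mul_le_mul_of_nonneg_right (by linarith) (by linarith)
      have h4b : g * (1 - 2 * lam) ≤ g * (2 * (1 - lam)) := mul_le_mul_of_nonneg_left (by linarith) hg0.le
      have h5 : (k₁ : ℝ) * ((1 - g) * (1 - 2 * lam)) ≤ (k₁ : ℝ) * (2 * ((1 - lam) * g)) := by
        refine mul_le_mul_of_nonneg_left ?_ hk₁0
        linarith
      have h6 : 2 * (k₁ : ℝ) * ((1 - lam) * g) ≤ (t - ((k₁ : ℝ) + a)) * ((1 - lam) * g) :=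
        mul_le_mul_of_nonneg_right htl (mul_nonneg (by linarith) hg0.le)
      have h7 : (k₁ : ℝ) * ((1 - g) * (1 - 2 * lam)) ≤ (t - ((k₁ : ℝ) + a)) * ((1 - lam) * g) := by linarith
      calc (k₁ : ℝ) * (A - C) = (1 - z) * ((k₁ : ℝ) * ((1 - g) * (1 - 2 * lam))) := by rw [eAC]; ring
        _ ≤ (1 - z) * ((t - ((k₁ : ℝ) + a)) * ((1 - lam) * g)) := mul_le_mul_of_nonneg_left h7 h1z.le
        _ = (t - ((k₁ : ℝ) + a)) * B := by simp only [hB]; ring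
  -- hence u(z + A) ≤ D
  have hzA : y / (1 - y) * (z + A) ≤ D := by
    have h1 : ((k₂ : ℝ) - t) * C ≤ -(k₁ : ℝ) * C := mul_le_mul_of_nonneg_right (by linarith) hC0
    have e0 : t * (z + A) = t * z + t * A := by ring
    have h2 : t * (z + A) ≤ t * (1 - y) / y * D := by linarith [eMI, hGiant, hkey, h1, e0]
    have e2 : t * (1 - y) / y * D = t * (D / (y / (1 - y))) := by field_simp
    rw [e2] at h2
    have h3 : z + A ≤ D / (y / (1 - y)) := le_of_mul_le_mul_left h2 htpos
    rwa [le_div_iff₀ hu0, mul_comm] at h3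
  have hfin : t * z ≤ t * (1 - y) / y * (D - y / (1 - y) * A) := by
    have e4 : t * (1 - y) / y * (D - y / (1 - y) * A) = t * (1 - y) / y * D - t * A := by field_simp
    have h6 := mul_le_mul_of_nonneg_left hzA (show 0 ≤ t * (1 - y) / y by positivity)
    have e6 : t * (1 - y) / y * (y / (1 - y) * (z + A)) = t * z + t * A := by field_simp
    linarith [h6, e6, e4]
  have hnj : ¬ (j + 1 ≤ k₂) := by omega
  refine mixLawQ_decAtT_of_routing_deep y z g S lam a j M k₁ k₂ 0 A B 0 hy0 hy1 hz0 hz1 hg1 hyg ha1 hta hk hk₂M hlam0 hlam1 hmean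
    hk₁ hPj hPlow (Or.inl hk₂mid) hG le_rfl hA0 hB0 le_rfl (by ring) (by ring) (fun h0 => absurd h0 (lt_irrefl 0))
    (fun _ => Or.inr hcomp) (by rw [mul_zero, zero_add]; exact hsat) ?_ ?_
  · rw [hUG, mul_zero, add_zero]
    nlinarith [mul_nonneg hu0.le hz0]
  · rw [if_neg hnj, hUG, mul_zero, mul_zero, zero_add, add_zero]
    have hκ : 0 ≤ (if t < (k₂ : ℝ) then (k₂ : ℝ) - t else 0) * (C - usage y t j (k₁ + a) k₂ * B) := by
      refine mul_nonneg ?_ (by linarith [hsat])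
      split_ifs with h
      · linarith
      · exact le_rfl
    linarith [hκ, hfin]


end LawDec

end Quant

end Summit.CriticalPhenomena.PercolationContinuityZ3.Theorems
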